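import Mathlib
import Literature.Probability.RandomPlanarGeometry.HexDomainSingleton
import Literature.Probability.LatticeModels.TriangularLatticeProofs
import HarnessLib

/-!
# The exterior of a ball of the honeycomb lattice is connected
(helper `tm_exterior_preconnected` for the stub `stub_telescopingRecursion` of the line
`tip-martingale-depth-induction`, crux `DefectDecoherence`, stmt-CriticalPhenomena-8549)

For every face centre `c_v` of `ℍ` and every real `s`, the vertices of `ℍ` whose centres lie at
distance `> s` from `c_v` induce a preconnected subgraph of `hexGraph`.  This is the lattice input
for the simple connectivity of the PICTURE DOMAINS `B(v,s) ∖ (prefix)` of the line (their complement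
is this exterior region with the near part of the prefix hanging off it).

Proof: every vertex has a neighbour farther from `c_v` by `≥ 1/3` in squared distance
(`exists_adj_farther`), so exterior vertices escape far inside the exterior (`exists_pathIn_far`);
a far vertex is routed horizontally away from `c_v` (`lt_dist_shift`) to a large lattice frame
around `v` lying outside the ball (`lt_dist_of_offset`), then along it to its corner (`pathIn_corner`).

Sources: H. Duminil-Copin, S. Smirnov, *The connective constant of the honeycomb lattice equals
`√(2+√2)`*, Ann. of Math. 175 (2012) (arXiv:1007.0575), §1–§2 (walks between mid-edges, windings,
Definition 1); the line card `Lines/tip-martingale-depth-induction.md` of the crux.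
Deliberately NOT here: anything about self-avoiding walks.
-/

noncomputable section

open scoped BigOperators ComplexConjugate Classical
open Literature.Probability.LatticeModels Literature.Probability.RandomPlanarGeometry.SAW
open Literature.Probability.Percolation (PathIn)

namespace Summit.CriticalPhenomena.SAWScalingLimit.Theorems.DefectDecoherence.TipMartingale

section Exterior

/-- Squared distance of two face centres as the quadratic form of `𝕋`. [folklore] -/
theorem normSq_sub (x y : Site 2) (i j : Fin 2) :
    Complex.normSq (hexCenter (x, i) - hexCenter (y, j)) =
      (((x 0 - y 0 : ℤ) : ℝ) + ((i : ℕ) - (j : ℕ) : ℝ) / 3) ^ 2 +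
      (((x 0 - y 0 : ℤ) : ℝ) + ((i : ℕ) - (j : ℕ) : ℝ) / 3) *
        (((x 1 - y 1 : ℤ) : ℝ) + ((i : ℕ) - (j : ℕ) : ℝ) / 3) +
      (((x 1 - y 1 : ℤ) : ℝ) + ((i : ℕ) - (j : ℕ) : ℝ) / 3) ^ 2 := by
  rw [hexCenter_sub_hexCenter, normSq_add_mul_triZeta]

/-- `dist² = normSq`. [folklore] -/
theorem dist_sq_eq_normSq (a b : HexVertex) :
    dist (hexCenter a) (hexCenter b) ^ 2 = Complex.normSq (hexCenter a - hexCenter b) := by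
  rw [Complex.dist_eq, Complex.sq_norm]

/-- **Every vertex of `ℍ` has a neighbour strictly farther from any given centre**: the squared
distance grows by at least `1/3` (the three edge directions at a vertex sum to zero). [folklore] -/
theorem exists_adj_farther (v y : HexVertex) : ∃ y', hexGraph.Adj y y' ∧
    Complex.normSq (hexCenter y - hexCenter v) + 1 / 3 ≤
      Complex.normSq (hexCenter y' - hexCenter v) := by
  obtain ⟨p, j⟩ := v
  obtain ⟨x, k⟩ := y
  have e0 : ∀ z : Site 2, (z - (Pi.single 0 1 : Site 2)) 0 = z 0 - 1 ∧
      (z - (Pi.single 0 1 : Site 2)) 1 = z 1 ∧ (z + (Pi.single 0 1 : Site 2)) 0 = z 0 + 1 ∧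
      (z + (Pi.single 0 1 : Site 2)) 1 = z 1 ∧ (z - (Pi.single 1 1 : Site 2)) 0 = z 0 ∧
      (z - (Pi.single 1 1 : Site 2)) 1 = z 1 - 1 ∧ (z + (Pi.single 1 1 : Site 2)) 0 = z 0 ∧
      (z + (Pi.single 1 1 : Site 2)) 1 = z 1 + 1 := fun z => by simp
  fin_cases k
  · -- up face: neighbours `(x,1)`, `(x - e₀, 1)`, `(x - e₁, 1)`
    set A : ℝ := ((x 0 - p 0 : ℤ) : ℝ) + (((0 : Fin 2) : ℕ) - (j : ℕ) : ℝ) / 3 with hA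
    set B : ℝ := ((x 1 - p 1 : ℤ) : ℝ) + (((0 : Fin 2) : ℕ) - (j : ℕ) : ℝ) / 3 with hB
    rcases le_or_gt 0 (A + B) with h | h
    · refine ⟨(x, 1), (hexGraph_adj_iff_of_snd_eq_zero_holds x x).2 (Or.inl rfl), ?_⟩
      simp only [Fin.zero_eta, Fin.isValue, normSq_sub, Fin.val_zero, Fin.val_one, Nat.cast_zero,
        Nat.cast_one] at *
      push_cast [e0] at *
      nlinarith [h]
    · rcases le_or_gt A 0 with h' | h'
      · refine ⟨(x - Pi.single 0 1, 1),
          (hexGraph_adj_iff_of_snd_eq_zero_holds x _).2 (Or.inr (Or.inl rfl)), ?_⟩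
        simp only [Fin.zero_eta, Fin.isValue, normSq_sub, Fin.val_zero, Fin.val_one, Nat.cast_zero,
        Nat.cast_one] at *
        push_cast [e0] at *
        nlinarith [h']
      · refine ⟨(x - Pi.single 1 1, 1),
          (hexGraph_adj_iff_of_snd_eq_zero_holds x _).2 (Or.inr (Or.inr rfl)), ?_⟩
        simp only [Fin.zero_eta, Fin.isValue, normSq_sub, Fin.val_zero, Fin.val_one, Nat.cast_zero,
        Nat.cast_one] at *
        push_cast [e0] at *
        nlinarith [h, h']
  · -- down face: neighbours `(x,0)`, `(x + e₀, 0)`, `(x + e₁, 0)`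
    set A : ℝ := ((x 0 - p 0 : ℤ) : ℝ) + (((1 : Fin 2) : ℕ) - (j : ℕ) : ℝ) / 3 with hA
    set B : ℝ := ((x 1 - p 1 : ℤ) : ℝ) + (((1 : Fin 2) : ℕ) - (j : ℕ) : ℝ) / 3 with hB
    rcases le_or_gt (A + B) 0 with h | h
    · refine ⟨(x, 0), (hexGraph_adj_iff_of_snd_eq_one x x).2 (Or.inl rfl), ?_⟩
      simp only [Fin.mk_one, Fin.isValue, normSq_sub, Fin.val_zero, Fin.val_one, Nat.cast_zero,
        Nat.cast_one] at *
      push_cast [e0] at *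
      nlinarith [h]
    · rcases le_or_gt 0 A with h' | h'
      · refine ⟨(x + Pi.single 0 1, 0),
          (hexGraph_adj_iff_of_snd_eq_one x _).2 (Or.inr (Or.inl rfl)), ?_⟩
        simp only [Fin.mk_one, Fin.isValue, normSq_sub, Fin.val_zero, Fin.val_one, Nat.cast_zero,
        Nat.cast_one] at *
        push_cast [e0] at *
        nlinarith [h']
      · refine ⟨(x + Pi.single 1 1, 0),
          (hexGraph_adj_iff_of_snd_eq_one x _).2 (Or.inr (Or.inr rfl)), ?_⟩
        simp only [Fin.mk_one, Fin.isValue, normSq_sub, Fin.val_zero, Fin.val_one, Nat.cast_zero,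
        Nat.cast_one] at *
        push_cast [e0] at *
        nlinarith [h, h']

/-- Distances to `c_v` compare like squared distances. [folklore] -/
theorem dist_le_of_normSq_le {a b v : HexVertex}
    (h : Complex.normSq (hexCenter a - hexCenter v) ≤ Complex.normSq (hexCenter b - hexCenter v)) :
    dist (hexCenter a) (hexCenter v) ≤ dist (hexCenter b) (hexCenter v) := by
  rw [← abs_of_nonneg (dist_nonneg : 0 ≤ dist (hexCenter a) (hexCenter v)),
    ← abs_of_nonneg (dist_nonneg : 0 ≤ dist (hexCenter b) (hexCenter v)), ← sq_le_sq,
    dist_sq_eq_normSq, dist_sq_eq_normSq]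
  exact h

/-- **Escape**: from any vertex outside `B(v,s)` there is a path outside `B(v,s)` to vertices
arbitrarily far from `c_v`. [folklore] -/
theorem exists_pathIn_far (v : HexVertex) (s : ℝ) : ∀ (n : ℕ) (y : HexVertex),
    s < dist (hexCenter y) (hexCenter v) →
      ∃ y', PathIn hexGraph {x | s < dist (hexCenter x) (hexCenter v)} y y' ∧
        Complex.normSq (hexCenter y - hexCenter v) + n / 3 ≤
          Complex.normSq (hexCenter y' - hexCenter v)
  | 0, y, hy => ⟨y, PathIn.refl hy, by simp⟩
  | n + 1, y, hy => by
    obtain ⟨y', hp, hn⟩ := exists_pathIn_far v s n y hy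
    obtain ⟨y'', hadj, hfar⟩ := exists_adj_farther v y'
    have hy' : s < dist (hexCenter y') (hexCenter v) := hp.right_mem
    have hy'' : s < dist (hexCenter y'') (hexCenter v) :=
      lt_of_lt_of_le hy' (dist_le_of_normSq_le (by linarith))
    exact ⟨y'', hp.tail hadj hy'', by push_cast; linarith⟩

/-! #### Lattice moves in coordinates -/

/-- `(x,0) ∼ (x,1)`. [folklore] -/
theorem adj_up (x : Site 2) : hexGraph.Adj (x, 0) (x, 1) :=
  (hexGraph_adj_iff_of_snd_eq_zero_holds x x).2 (Or.inl rfl)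

/-- `(x,1) ∼ (x + e₀, 0)`. [folklore] -/
theorem adj_e0 (x : Site 2) : hexGraph.Adj (x, 1) (x + Pi.single 0 1, 0) :=
  (hexGraph_adj_iff_of_snd_eq_one x _).2 (Or.inr (Or.inl rfl))

/-- `(x,1) ∼ (x + e₁, 0)`. [folklore] -/
theorem adj_e1 (x : Site 2) : hexGraph.Adj (x, 1) (x + Pi.single 1 1, 0) :=
  (hexGraph_adj_iff_of_snd_eq_one x _).2 (Or.inr (Or.inr rfl))

/-- `(x,0) ∼ (x - e₀, 1)`. [folklore] -/
theorem adj_w0 (x : Site 2) : hexGraph.Adj (x, 0) (x - Pi.single 0 1, 1) :=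
  (hexGraph_adj_iff_of_snd_eq_zero_holds x _).2 (Or.inr (Or.inl rfl))

/-- Moving `m` cells in direction `e₀` inside a set `A`. [folklore] -/
theorem pathIn_right {A : Set HexVertex} (x : Site 2) (k : Fin 2) : ∀ m : ℕ,
    (∀ i : ℕ, i ≤ m → ∀ k' : Fin 2, (x + (i : ℤ) • (Pi.single 0 1 : Site 2), k') ∈ A) →
      PathIn hexGraph A (x, k) (x + (m : ℤ) • (Pi.single 0 1 : Site 2), 1)
  | 0, hA => by
    have h0 : ∀ k', (x, k') ∈ A := fun k' => by simpa using hA 0 le_rfl k'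
    simp only [Nat.cast_zero, zero_smul, add_zero]
    fin_cases k
    · exact PathIn.of_adj (h0 0) (h0 1) (adj_up x)
    · exact PathIn.refl (h0 1)
  | m + 1, hA => by
    have ih := pathIn_right x k m fun i hi k' => hA i (hi.trans m.le_succ) k'
    have h1 := hA (m + 1) le_rfl
    have e : x + ((m + 1 : ℕ) : ℤ) • (Pi.single 0 1 : Site 2) =
        x + (m : ℤ) • (Pi.single 0 1 : Site 2) + Pi.single 0 1 := by
      rw [Nat.cast_succ, add_smul, one_smul, add_assoc]
    rw [e] at h1 ⊢
    exact (ih.tail (adj_e0 _) (h1 0)).tail (adj_up _) (h1 1)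

/-- Moving `m` cells in direction `e₁` inside a set `A`. [folklore] -/
theorem pathIn_up {A : Set HexVertex} (x : Site 2) (k : Fin 2) : ∀ m : ℕ,
    (∀ i : ℕ, i ≤ m → ∀ k' : Fin 2, (x + (i : ℤ) • (Pi.single 1 1 : Site 2), k') ∈ A) →
      PathIn hexGraph A (x, k) (x + (m : ℤ) • (Pi.single 1 1 : Site 2), 1)
  | 0, hA => by
    have h0 : ∀ k', (x, k') ∈ A := fun k' => by simpa using hA 0 le_rfl k'
    simp only [Nat.cast_zero, zero_smul, add_zero]
    fin_cases k
    · exact PathIn.of_adj (h0 0) (h0 1) (adj_up x)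
    · exact PathIn.refl (h0 1)
  | m + 1, hA => by
    have ih := pathIn_up x k m fun i hi k' => hA i (hi.trans m.le_succ) k'
    have h1 := hA (m + 1) le_rfl
    have e : x + ((m + 1 : ℕ) : ℤ) • (Pi.single 1 1 : Site 2) =
        x + (m : ℤ) • (Pi.single 1 1 : Site 2) + Pi.single 1 1 := by
      rw [Nat.cast_succ, add_smul, one_smul, add_assoc]
    rw [e] at h1 ⊢
    exact (ih.tail (adj_e1 _) (h1 0)).tail (adj_up _) (h1 1)

/-- Moving `m` cells in direction `-e₀` inside a set `A`. [folklore] -/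
theorem pathIn_left {A : Set HexVertex} (x : Site 2) (k : Fin 2) : ∀ m : ℕ,
    (∀ i : ℕ, i ≤ m → ∀ k' : Fin 2, (x - (i : ℤ) • (Pi.single 0 1 : Site 2), k') ∈ A) →
      PathIn hexGraph A (x, k) (x - (m : ℤ) • (Pi.single 0 1 : Site 2), 0)
  | 0, hA => by
    have h0 : ∀ k', (x, k') ∈ A := fun k' => by simpa using hA 0 le_rfl k'
    simp only [Nat.cast_zero, zero_smul, sub_zero]
    fin_cases k
    · exact PathIn.refl (h0 0)
    · exact PathIn.of_adj (h0 1) (h0 0) (adj_up x).symm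
  | m + 1, hA => by
    have ih := pathIn_left x k m fun i hi k' => hA i (hi.trans m.le_succ) k'
    have h1 := hA (m + 1) le_rfl
    have e : x - ((m + 1 : ℕ) : ℤ) • (Pi.single 0 1 : Site 2) =
        x - (m : ℤ) • (Pi.single 0 1 : Site 2) - Pi.single 0 1 := by
      rw [Nat.cast_succ, add_smul, one_smul, sub_add_eq_sub_sub]
    rw [e] at h1 ⊢
    exact (ih.tail (adj_w0 _) (h1 1)).tail (adj_up _).symm (h1 0)

/-! #### Staying outside the ball -/

/-- Centres of horizontally shifted cells. [folklore] -/
theorem hexCenter_add_zsmul_e0 (x : Site 2) (m : ℤ) (k : Fin 2) :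
    hexCenter (x + m • (Pi.single 0 1 : Site 2), k) = hexCenter (x, k) + m := by
  simp only [hexCenter, triEmbed, Pi.add_apply, Pi.smul_apply, smul_eq_mul]
  simp
  ring

/-- The two faces of a cell have centres at distance `≤ 1/√3 < 1`. [folklore] -/
theorem norm_hexCenter_sub_same_cell (x : Site 2) (k k' : Fin 2) :
    ‖hexCenter (x, k') - hexCenter (x, k)‖ < 1 := by
  have h : ‖hexCenter (x, k') - hexCenter (x, k)‖ ^ 2 ≤ 1 / 3 := by
    rw [Complex.sq_norm, normSq_sub]
    have hk : ((k : ℕ) : ℝ) = 0 ∨ ((k : ℕ) : ℝ) = 1 := by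
      fin_cases k <;> simp
    have hk' : ((k' : ℕ) : ℝ) = 0 ∨ ((k' : ℕ) : ℝ) = 1 := by
      fin_cases k' <;> simp
    simp only [sub_self, Int.cast_zero, zero_add]
    rcases hk with h | h <;> rcases hk' with h' | h' <;> rw [h, h'] <;> norm_num
  nlinarith [norm_nonneg (hexCenter (x, k') - hexCenter (x, k))]

/-- **Horizontal rays stay outside the ball**: if `c(x,k) - c_v` has real part of the same sign as
the shift `m` and `(x,k)` is at distance `≥ s + 1`, then `(x + m e₀, k')` is at distance `> s`.
[folklore] -/
theorem lt_dist_shift {v : HexVertex} {s : ℝ} {x : Site 2} {k : Fin 2}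
    (hfar : s + 1 ≤ dist (hexCenter (x, k)) (hexCenter v)) (m : ℤ)
    (hre : 0 ≤ (hexCenter (x, k) - hexCenter v).re * m) (k' : Fin 2) :
    s < dist (hexCenter (x + m • (Pi.single 0 1 : Site 2), k')) (hexCenter v) := by
  set w := hexCenter (x, k) - hexCenter v with hw
  set δ := hexCenter (x, k') - hexCenter (x, k) with hδ
  have hδ1 : ‖δ‖ < 1 := norm_hexCenter_sub_same_cell x k k'
  have h1 : ‖w‖ ≤ ‖w + m‖ := by
    rw [← abs_of_nonneg (norm_nonneg w), ← abs_of_nonneg (norm_nonneg (w + m)), ← sq_le_sq,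
      Complex.sq_norm, Complex.sq_norm, Complex.normSq_apply, Complex.normSq_apply]
    simp only [Complex.add_re, Complex.intCast_re, Complex.add_im, Complex.intCast_im, add_zero]
    nlinarith [sq_nonneg (m : ℝ)]
  have h2 : ‖w + m‖ ≤ ‖w + m + δ‖ + ‖δ‖ := by
    have := norm_sub_le (w + m + δ) δ
    rwa [add_sub_cancel_right] at this
  rw [Complex.dist_eq, hexCenter_add_zsmul_e0,
    show hexCenter (x, k') + m - hexCenter v = w + m + δ by rw [hw, hδ]; ring]
  rw [Complex.dist_eq, ← hw] at hfar
  linarith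

/-- **The frame is outside the ball**: a vertex whose cell is at horizontal or vertical lattice
offset `±K` from `v`'s cell, `K ≥ 2s + 1`, is at distance `> s` from `c_v`. [folklore] -/
theorem lt_dist_of_offset {v : HexVertex} {s : ℝ} (hs : 0 ≤ s) {K : ℕ} (hK : 2 * s + 1 ≤ K)
    {x : Site 2} (k : Fin 2)
    (hx : x 0 - v.1 0 = K ∨ x 0 - v.1 0 = -K ∨ x 1 - v.1 1 = K ∨ x 1 - v.1 1 = -K) :
    s < dist (hexCenter (x, k)) (hexCenter v) := by
  obtain ⟨p, j⟩ := v
  have hk : 0 ≤ ((k : ℕ) : ℝ) ∧ ((k : ℕ) : ℝ) ≤ 1 := by fin_cases k <;> simp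
  have hj : 0 ≤ ((j : ℕ) : ℝ) ∧ ((j : ℕ) : ℝ) ≤ 1 := by fin_cases j <;> simp
  have hsq : s ^ 2 < dist (hexCenter (x, k)) (hexCenter (p, j)) ^ 2 := by
    rw [dist_sq_eq_normSq, normSq_sub]
    set t : ℝ := ((k : ℕ) - (j : ℕ) : ℝ) / 3 with ht
    have ht1 : -1 / 3 ≤ t ∧ t ≤ 1 / 3 := by constructor <;> rw [ht] <;> linarith [hk.1, hk.2, hj.1, hj.2]
    set A : ℝ := ((x 0 - p 0 : ℤ) : ℝ) + t
    set B : ℝ := ((x 1 - p 1 : ℤ) : ℝ) + t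
    have key : ∀ A B : ℝ, (K - 1 / 3) ^ 2 ≤ A ^ 2 → s ^ 2 < A ^ 2 + A * B + B ^ 2 := by
      intro A B hA
      nlinarith [sq_nonneg (A / 2 + B)]
    dsimp only at hx
    rcases hx with h | h | h | h
    · have hA : ((x 0 - p 0 : ℤ) : ℝ) = K := by exact_mod_cast h
      exact key A B (by nlinarith [ht1.1, ht1.2])
    · have hA : ((x 0 - p 0 : ℤ) : ℝ) = -K := by exact_mod_cast h
      exact key A B (by nlinarith [ht1.1, ht1.2])
    · have hB : ((x 1 - p 1 : ℤ) : ℝ) = K := by exact_mod_cast h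
      have := key B A (by nlinarith [ht1.1, ht1.2]); linarith
    · have hB : ((x 1 - p 1 : ℤ) : ℝ) = -K := by exact_mod_cast h
      have := key B A (by nlinarith [ht1.1, ht1.2]); linarith
  exact lt_of_pow_lt_pow_left₀ 2 dist_nonneg hsq

/-! #### Routing a far vertex to the corner of a large frame -/

/-- **Routing to the corner**: a vertex at distance `≥ s + 1` from `c_v` whose cell lies within
lattice offset `K` of `v`'s cell (`K ≥ 2s + 1`) is joined outside `B(v,s)` to the corner
`(v + K(e₀ + e₁), 1)`: horizontally away from `v` to the frame, then along the frame. [folklore] -/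
theorem pathIn_corner {v : HexVertex} {s : ℝ} (hs : 0 ≤ s) {K : ℕ} (hK : 2 * s + 1 ≤ K)
    {x : Site 2} {k : Fin 2} (hfar : s + 1 ≤ dist (hexCenter (x, k)) (hexCenter v))
    (h0 : |x 0 - v.1 0| ≤ K) (h1 : |x 1 - v.1 1| ≤ K) :
    PathIn hexGraph {y | s < dist (hexCenter y) (hexCenter v)} (x, k)
      (v.1 + (K : ℤ) • (Pi.single 0 1 + Pi.single 1 1 : Site 2), 1) := by
  obtain ⟨p, j⟩ := v
  dsimp only at h0 h1 ⊢
  obtain ⟨h0l, h0r⟩ := abs_le.1 h0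
  obtain ⟨h1l, h1r⟩ := abs_le.1 h1
  obtain ⟨m₂, hm₂⟩ : ∃ m₂ : ℕ, (m₂ : ℤ) = p 1 + K - x 1 :=
    ⟨(p 1 + K - x 1).toNat, Int.toNat_of_nonneg (by omega)⟩
  rcases le_or_gt 0 (hexCenter (x, k) - hexCenter (p, j)).re with hre | hre
  · -- right to the right side of the frame, then up to the corner
    obtain ⟨m₁, hm₁⟩ : ∃ m₁ : ℕ, (m₁ : ℤ) = p 0 + K - x 0 :=
      ⟨(p 0 + K - x 0).toNat, Int.toNat_of_nonneg (by omega)⟩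
    have leg1 : PathIn hexGraph {y | s < dist (hexCenter y) (hexCenter (p, j))} (x, k)
        (x + (m₁ : ℤ) • (Pi.single 0 1 : Site 2), 1) :=
      pathIn_right x k m₁ fun i _ k' => lt_dist_shift hfar i (mul_nonneg hre (by positivity)) k'
    have leg2 : PathIn hexGraph {y | s < dist (hexCenter y) (hexCenter (p, j))}
        (x + (m₁ : ℤ) • (Pi.single 0 1 : Site 2), 1)
        (x + (m₁ : ℤ) • (Pi.single 0 1 : Site 2) + (m₂ : ℤ) • (Pi.single 1 1 : Site 2), 1) :=
      pathIn_up _ 1 m₂ fun i _ k' => lt_dist_of_offset hs hK k' (Or.inl (by simp; omega))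
    have e : x + (m₁ : ℤ) • (Pi.single 0 1 : Site 2) + (m₂ : ℤ) • (Pi.single 1 1 : Site 2) =
        p + (K : ℤ) • (Pi.single 0 1 + Pi.single 1 1 : Site 2) := by
      funext i; fin_cases i <;> simp <;> omega
    rw [e] at leg2
    exact leg1.trans leg2
  · -- left to the left side, up to the top-left corner, right along the top side
    obtain ⟨m₁, hm₁⟩ : ∃ m₁ : ℕ, (m₁ : ℤ) = x 0 - (p 0 - K) :=
      ⟨(x 0 - (p 0 - K)).toNat, Int.toNat_of_nonneg (by omega)⟩
    have leg1 : PathIn hexGraph {y | s < dist (hexCenter y) (hexCenter (p, j))} (x, k)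
        (x - (m₁ : ℤ) • (Pi.single 0 1 : Site 2), 0) :=
      pathIn_left x k m₁ fun i _ k' => by
        have h := lt_dist_shift hfar (-(i : ℤ))
          (mul_nonneg_of_nonpos_of_nonpos hre.le (by simp)) k'
        rwa [neg_smul, ← sub_eq_add_neg] at h
    have leg2 : PathIn hexGraph {y | s < dist (hexCenter y) (hexCenter (p, j))}
        (x - (m₁ : ℤ) • (Pi.single 0 1 : Site 2), 0)
        (x - (m₁ : ℤ) • (Pi.single 0 1 : Site 2) + (m₂ : ℤ) • (Pi.single 1 1 : Site 2), 1) :=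
      pathIn_up _ 0 m₂ fun i _ k' => lt_dist_of_offset hs hK k' (Or.inr (Or.inl (by simp; omega)))
    have leg3 : PathIn hexGraph {y | s < dist (hexCenter y) (hexCenter (p, j))}
        (x - (m₁ : ℤ) • (Pi.single 0 1 : Site 2) + (m₂ : ℤ) • (Pi.single 1 1 : Site 2), 1)
        (x - (m₁ : ℤ) • (Pi.single 0 1 : Site 2) + (m₂ : ℤ) • (Pi.single 1 1 : Site 2) +
          ((2 * K : ℕ) : ℤ) • (Pi.single 0 1 : Site 2), 1) :=
      pathIn_right _ 1 (2 * K) fun i _ k' =>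
        lt_dist_of_offset hs hK k' (Or.inr (Or.inr (Or.inl (by simp; omega))))
    have e : x - (m₁ : ℤ) • (Pi.single 0 1 : Site 2) + (m₂ : ℤ) • (Pi.single 1 1 : Site 2) +
        ((2 * K : ℕ) : ℤ) • (Pi.single 0 1 : Site 2) =
        p + (K : ℤ) • (Pi.single 0 1 + Pi.single 1 1 : Site 2) := by
      funext i; fin_cases i <;> simp <;> omega
    rw [e] at leg3
    exact (leg1.trans leg2).trans leg3

/-- **THE EXTERIOR OF A BALL IS CONNECTED**: the vertices of `ℍ` at distance `> s` from a
face centre `c_v` induce a preconnected subgraph (escape radially, then route along a large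
lattice frame surrounding the ball). [folklore] -/
theorem exterior_preconnected (v : HexVertex) (s : ℝ) :
    (hexGraph.induce {x | s < dist (hexCenter x) (hexCenter v)}).Preconnected := by
  refine preconnected_induce_of_forall_pathIn fun a ha b hb => ?_
  set s0 := max s 0 with hs0
  have hs0p : 0 ≤ s0 := le_max_right _ _
  have hss : s ≤ s0 := le_max_left _ _
  have hmono : {x : HexVertex | s0 < dist (hexCenter x) (hexCenter v)} ⊆
      {x | s < dist (hexCenter x) (hexCenter v)} := fun x hx => lt_of_le_of_lt hss hx
  -- escape beyond distance `s0 + 1`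
  obtain ⟨n, hn⟩ := exists_nat_ge (3 * (s0 + 1) ^ 2)
  have far : ∀ y, s < dist (hexCenter y) (hexCenter v) →
      ∃ y', PathIn hexGraph {x | s < dist (hexCenter x) (hexCenter v)} y y' ∧
        s0 + 1 ≤ dist (hexCenter y') (hexCenter v) := by
    intro y hy
    obtain ⟨y', hp, hy'⟩ := exists_pathIn_far v s n y hy
    refine ⟨y', hp, ?_⟩
    have hsq : (s0 + 1) ^ 2 ≤ dist (hexCenter y') (hexCenter v) ^ 2 := by
      rw [dist_sq_eq_normSq]
      nlinarith [Complex.normSq_nonneg (hexCenter y - hexCenter v)]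
    exact (pow_le_pow_iff_left₀ (by positivity) dist_nonneg two_ne_zero).1 hsq
  obtain ⟨a', pa, ha'⟩ := far a ha
  obtain ⟨b', pb, hb'⟩ := far b hb
  -- a frame containing both far vertices
  obtain ⟨K, hK, hKa0, hKa1, hKb0, hKb1⟩ : ∃ K : ℕ, 2 * s0 + 1 ≤ K ∧ |a'.1 0 - v.1 0| ≤ K ∧
      |a'.1 1 - v.1 1| ≤ K ∧ |b'.1 0 - v.1 0| ≤ K ∧ |b'.1 1 - v.1 1| ≤ K := by
    obtain ⟨K₀, hK₀⟩ := exists_nat_ge (2 * s0 + 1)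
    refine ⟨K₀ + (a'.1 0 - v.1 0).natAbs + (a'.1 1 - v.1 1).natAbs + (b'.1 0 - v.1 0).natAbs +
      (b'.1 1 - v.1 1).natAbs, ?_, ?_, ?_, ?_, ?_⟩
    · have h : (K₀ : ℝ) ≤ ((K₀ + (a'.1 0 - v.1 0).natAbs + (a'.1 1 - v.1 1).natAbs +
          (b'.1 0 - v.1 0).natAbs + (b'.1 1 - v.1 1).natAbs : ℕ) : ℝ) := by
        exact_mod_cast Nat.le_add_right_of_le (Nat.le_add_right_of_le
          (Nat.le_add_right_of_le (Nat.le_add_right _ _)))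
      linarith
    all_goals push_cast [Int.natCast_natAbs]
    all_goals
      linarith [abs_nonneg (a'.1 0 - v.1 0), abs_nonneg (a'.1 1 - v.1 1),
        abs_nonneg (b'.1 0 - v.1 0), abs_nonneg (b'.1 1 - v.1 1), (Nat.cast_nonneg K₀ : (0 : ℤ) ≤ K₀)]
  obtain ⟨xa, ka⟩ := a'
  obtain ⟨xb, kb⟩ := b'
  have ra := pathIn_corner hs0p hK ha' hKa0 hKa1
  have rb := pathIn_corner hs0p hK hb' hKb0 hKb1
  exact (pa.trans (ra.mono hmono)).trans (pb.trans (rb.mono hmono)).symm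

end Exterior

/-- **Registered helper `tm_exterior_preconnected`**: the exterior of every ball of `ℍ` is
preconnected. [folklore] -/
theorem tm_exterior_preconnected : ∀ (v : HexVertex) (s : ℝ),
    (hexGraph.induce {x | s < dist (hexCenter x) (hexCenter v)}).Preconnected :=
  exterior_preconnected

end Summit.CriticalPhenomena.SAWScalingLimit.Theorems.DefectDecoherence.TipMartingale

end
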